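import Summits.Ventures.PercRepro.RankLevelSetHallRuleLUniformTools

/-!
# PercRepro — THE BAD SETS OF A PAVING SET: HYPERPLANE PARTS AND COMPLEMENT PARTS (p4, gen 31; C-044, UP form at the
tight layer; paper proofs/P4-CELL-THREE.md §14.14)

Let `G ⊆ E` be a finite set of rank `q ≥ 1` that is PAVING (every subset of `G` with at most `q − 1` elements is
independent).  A `(q−1)`-subset `A ⊆ G` is BAD when some `e ∈ G ∖ A` lies in `cl A` (`A` is not closed in `G`); its
HYPERPLANE PART is `H(A) := G ∩ cl A` (a hyperplane of `M|G` with at least `q` points, `card_hypPart_ge`) and its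
COMPLEMENT PART `K(A) := G ∖ H(A)` (nonempty, `card_compPart_pos`; at most `#G − q` points, `card_compPart_le`).  Two
bad sets with different hyperplane parts have `#(H(A) ∩ H(A′)) ≤ q − 2` (`card_inter_hypPart_le`: a `(q−1)`-subset of
the intersection would be a common basis of both closures), equivalently `#(K(A) ∪ K(A′)) ≥ #G − q + 2`
(`card_union_compPart_ge`).  The count `#bad ≤ C(#G, q)` is RankLevelSetHallRuleLPavingCount.  Axioms standard.
-/

namespace PercRepro

open Set Matroid Finset

variable {α : Type} [DecidableEq α] (M : Matroid α)

/-- The **bad `(q−1)`-subsets** of the finset `G`: the `(q−1)`-subsets `A ⊆ G` with some `e ∈ G ∖ A` in `cl A`. -/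
noncomputable def badSets (q : ℕ) (G : Finset α) : Finset (Finset α) := by
  classical
  exact (G.powersetCard (q - 1)).filter (fun A => ∃ e ∈ G, e ∉ A ∧ e ∈ M.closure (A : Set α))

/-- The **hyperplane part** `H(A) := G ∩ cl A` of a subset `A` of `G`. -/
noncomputable def hypPart (G A : Finset α) : Finset α := by
  classical
  exact G.filter (fun e => e ∈ M.closure (A : Set α))

/-- The **complement part** `K(A) := G ∖ H(A)`. -/
noncomputable def compPart (G A : Finset α) : Finset α := G \ hypPart M G A

/-- Membership in `badSets`. -/
lemma mem_badSets {q : ℕ} {G A : Finset α} :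
    A ∈ badSets M q G ↔ (A ⊆ G ∧ A.card = q - 1) ∧ ∃ e ∈ G, e ∉ A ∧ e ∈ M.closure (A : Set α) := by
  classical
  unfold badSets
  rw [Finset.mem_filter, Finset.mem_powersetCard]

omit [DecidableEq α] in
/-- Membership in `hypPart`. -/
lemma mem_hypPart {G A : Finset α} {e : α} : e ∈ hypPart M G A ↔ e ∈ G ∧ e ∈ M.closure (A : Set α) := by
  classical
  unfold hypPart
  rw [Finset.mem_filter]

omit [DecidableEq α] in
/-- `H(A) ⊆ G`. -/
lemma hypPart_subset (G A : Finset α) : hypPart M G A ⊆ G := fun _ h => ((mem_hypPart M).1 h).1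

/-- `K(A) ⊆ G`. -/
lemma compPart_subset (G A : Finset α) : compPart M G A ⊆ G := Finset.sdiff_subset

/-- `H(A) = G ∖ K(A)`. -/
lemma hypPart_eq_sdiff_compPart (G A : Finset α) : hypPart M G A = G \ compPart M G A := by
  unfold compPart
  rw [Finset.sdiff_sdiff_eq_self (hypPart_subset M G A)]

/-- `H(A)` and `K(A)` are disjoint. -/
lemma disjoint_hypPart_compPart (G A : Finset α) : Disjoint (hypPart M G A) (compPart M G A) :=
  Finset.disjoint_sdiff

omit [DecidableEq α] in
/-- If the closures agree, so do the hyperplane parts. -/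
lemma hypPart_congr {G A A' : Finset α} (h : M.closure (A : Set α) = M.closure (A' : Set α)) :
    hypPart M G A = hypPart M G A' := by
  classical
  unfold hypPart
  exact Finset.filter_congr (fun e _ => by rw [h])

/-- A bad set lies in its hyperplane part. -/
lemma subset_hypPart_of_mem_badSets {q : ℕ} {G A : Finset α} (hGE : (G : Set α) ⊆ M.E) (hA : A ∈ badSets M q G) :
    A ⊆ hypPart M G A := by
  intro x hx
  have hAG := ((mem_badSets M).1 hA).1.1
  rw [mem_hypPart]
  exact ⟨hAG hx, M.subset_closure (A : Set α) ((Finset.coe_subset.2 hAG).trans hGE) hx⟩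

/-- A bad set's hyperplane part has at least `q` points (`q ≥ 1`). -/
lemma card_hypPart_ge {q : ℕ} (hq : 1 ≤ q) {G A : Finset α} (hGE : (G : Set α) ⊆ M.E) (hA : A ∈ badSets M q G) :
    q ≤ (hypPart M G A).card := by
  classical
  obtain ⟨⟨hAG, hAcard⟩, e, heG, heA, hecl⟩ := (mem_badSets M).1 hA
  have hsub : insert e A ⊆ hypPart M G A := by
    rw [Finset.insert_subset_iff]
    exact ⟨(mem_hypPart M).2 ⟨heG, hecl⟩, subset_hypPart_of_mem_badSets M hGE hA⟩
  have := Finset.card_le_card hsub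
  rw [Finset.card_insert_of_notMem heA, hAcard] at this
  omega

/-- Every bad set (of a paving set of rank `q`) is independent. -/
lemma indep_of_mem_badSets {q : ℕ} {G A : Finset α}
    (hpav : ∀ A : Finset α, A ⊆ G → A.card ≤ q - 1 → M.Indep (A : Set α)) (hA : A ∈ badSets M q G) :
    M.Indep (A : Set α) :=
  hpav A ((mem_badSets M).1 hA).1.1 (le_of_eq ((mem_badSets M).1 hA).1.2)

/-- The closure of a bad set has rank `q − 1`. -/
lemma eRk_closure_of_mem_badSets {q : ℕ} {G A : Finset α}
    (hpav : ∀ A : Finset α, A ⊆ G → A.card ≤ q - 1 → M.Indep (A : Set α)) (hA : A ∈ badSets M q G) :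
    M.eRk (M.closure (A : Set α)) = ((q - 1 : ℕ) : ℕ∞) := by
  rw [M.eRk_closure_eq, (indep_of_mem_badSets M hpav hA).eRk_eq_encard, Set.encard_coe_eq_coe_finsetCard,
    ((mem_badSets M).1 hA).1.2]

/-- A bad set's complement part is nonempty: `G ⊆ cl A` would give `r(G) ≤ q − 1`. -/
lemma card_compPart_pos {q : ℕ} (hq : 1 ≤ q) {G A : Finset α} (hrk : M.eRk (G : Set α) = (q : ℕ∞))
    (hpav : ∀ A : Finset α, A ⊆ G → A.card ≤ q - 1 → M.Indep (A : Set α)) (hA : A ∈ badSets M q G) :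
    1 ≤ (compPart M G A).card := by
  classical
  by_contra hcon
  have hK : compPart M G A = ∅ := Finset.card_eq_zero.1 (by omega)
  have hGH : G ⊆ hypPart M G A := by
    unfold compPart at hK
    exact Finset.sdiff_eq_empty_iff_subset.1 hK
  have hGcl : (G : Set α) ⊆ M.closure (A : Set α) := fun x hx => ((mem_hypPart M).1 (hGH hx)).2
  have h1 : M.eRk (G : Set α) ≤ M.eRk (M.closure (A : Set α)) := M.eRk_mono hGcl
  rw [hrk, eRk_closure_of_mem_badSets M hpav hA] at h1
  have h2 : q ≤ q - 1 := by exact_mod_cast h1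
  omega

/-- A bad set's complement part has at most `#G − q` points. -/
lemma card_compPart_le {q : ℕ} (hq : 1 ≤ q) {G A : Finset α} (hGE : (G : Set α) ⊆ M.E) (hA : A ∈ badSets M q G) :
    (compPart M G A).card ≤ G.card - q := by
  have h1 := card_hypPart_ge M hq hGE hA
  have h2 : (compPart M G A).card = G.card - (hypPart M G A).card :=
    Finset.card_sdiff_of_subset (hypPart_subset M G A)
  omega

/-- `#H(A) = #G − #K(A)`. -/
lemma card_hypPart_eq {G A : Finset α} : (hypPart M G A).card = G.card - (compPart M G A).card := by
  rw [hypPart_eq_sdiff_compPart, Finset.card_sdiff_of_subset (compPart_subset M G A)]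

/-- **Two bad sets whose hyperplane parts share `q − 1` points have the same hyperplane part**: a `(q−1)`-subset `B` of
`H(A) ∩ H(A′)` is independent (paving) and lies in both closures, which have rank `q − 1`, so it is a basis of both. -/
lemma hypPart_eq_of_card_inter {q : ℕ} {G A A' : Finset α}
    (hpav : ∀ A : Finset α, A ⊆ G → A.card ≤ q - 1 → M.Indep (A : Set α))
    (hA : A ∈ badSets M q G) (hA' : A' ∈ badSets M q G)
    (h : q - 1 ≤ (hypPart M G A ∩ hypPart M G A').card) : hypPart M G A = hypPart M G A' := by
  classical
  obtain ⟨B, hBsub, hBcard⟩ := Finset.exists_subset_card_eq h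
  have hBG : B ⊆ G := hBsub.trans ((Finset.inter_subset_left).trans (hypPart_subset M G A))
  have hBind : M.Indep (B : Set α) := hpav B hBG (le_of_eq hBcard)
  have hBfin : (B : Set α).Finite := Finset.finite_toSet B
  -- B is a basis of cl A and of cl A'
  have key : ∀ C : Finset α, C ∈ badSets M q G → B ⊆ hypPart M G C → M.closure (B : Set α) = M.closure (C : Set α) := by
    intro C hC hBC
    have hBcl : (B : Set α) ⊆ M.closure (C : Set α) := fun x hx => ((mem_hypPart M).1 (hBC hx)).2
    have hrkB : M.eRk (M.closure (C : Set α)) ≤ M.eRk (B : Set α) := by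
      rw [eRk_closure_of_mem_badSets M hpav hC, hBind.eRk_eq_encard, Set.encard_coe_eq_coe_finsetCard, hBcard]
    have hbasis : M.IsBasis (B : Set α) (M.closure (C : Set α)) :=
      hBind.isBasis_of_eRk_ge hBfin hBcl hrkB (M.closure_subset_ground _)
    rw [hbasis.closure_eq_closure, M.closure_closure]
  have h1 := key A hA (hBsub.trans Finset.inter_subset_left)
  have h2 := key A' hA' (hBsub.trans Finset.inter_subset_right)
  exact hypPart_congr M (h1.symm.trans h2)

/-- Distinct hyperplane parts of bad sets share at most `q − 2` points (and then `q ≥ 2`). -/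
lemma card_inter_hypPart_le {q : ℕ} {G A A' : Finset α}
    (hpav : ∀ A : Finset α, A ⊆ G → A.card ≤ q - 1 → M.Indep (A : Set α))
    (hA : A ∈ badSets M q G) (hA' : A' ∈ badSets M q G) (hne : hypPart M G A ≠ hypPart M G A') :
    (hypPart M G A ∩ hypPart M G A').card + 2 ≤ q := by
  by_contra hcon
  exact hne (hypPart_eq_of_card_inter M hpav hA hA' (by omega))

/-- Distinct complement parts of bad sets cover all but at most `q − 2` points of `G`: `#G + 2 ≤ #(K(A) ∪ K(A′)) + q`. -/
lemma card_union_compPart_ge {q : ℕ} {G A A' : Finset α}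
    (hpav : ∀ A : Finset α, A ⊆ G → A.card ≤ q - 1 → M.Indep (A : Set α))
    (hA : A ∈ badSets M q G) (hA' : A' ∈ badSets M q G) (hne : compPart M G A ≠ compPart M G A') :
    G.card + 2 ≤ (compPart M G A ∪ compPart M G A').card + q := by
  classical
  have hneH : hypPart M G A ≠ hypPart M G A' := by
    intro h
    apply hne
    unfold compPart
    rw [h]
  have hint := card_inter_hypPart_le M hpav hA hA' hneH
  have hunion : compPart M G A ∪ compPart M G A' = G \ (hypPart M G A ∩ hypPart M G A') := by
    unfold compPart
    rw [Finset.sdiff_inter_distrib_right]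
  have hcard : (G \ (hypPart M G A ∩ hypPart M G A')).card = G.card - (hypPart M G A ∩ hypPart M G A').card :=
    Finset.card_sdiff_of_subset (Finset.inter_subset_left.trans (hypPart_subset M G A))
  have hle : (hypPart M G A ∩ hypPart M G A').card ≤ G.card :=
    Finset.card_le_card (Finset.inter_subset_left.trans (hypPart_subset M G A))
  rw [hunion, hcard]
  omega

end PercRepro
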